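import Summits.ResolutionOfSingularities.ResolutionOfSingularities.Theorems.WeightedInvariantHypersurfaceLocalGameEFT3
import Summits.ResolutionOfSingularities.ResolutionOfSingularities.Theorems.WeightedInvariantHypersurfaceLocalGameEFT4S
import Summits.ResolutionOfSingularities.ResolutionOfSingularities.Theorems.WeightedInvariantIotaOrder
import Summits.ResolutionOfSingularities.ResolutionOfSingularities.Theorems.WeightedInvariantOrderHasseZariskiNagata
import Literature.AlgebraicGeometry.Resolution.OriginLocalRing
import Literature.AlgebraicGeometry.Resolution.HasseSchmidtCoefficients
import Mathlib.Algebra.MvPolynomial.PDeriv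
import Mathlib.FieldTheory.Perfect
import HarnessLib

/-!
# Kernel specimen: the order function ALONE cannot be the `ι` of the canonical game clause —
# `¬ CanonicalGameClause p iotaOrd J` for every prime `p` and every `J` (door `HypersurfaceCentreConstruction`,
# stmt-ResolutionOfSingularities-19897, route `WeightedInvariant`; clause (c9′)(strat) of `…HypersurfaceLocalGameEFT3`)

[OURS · L1 W4.3 · cell `res-hironaka`, HUMAN RULING D-0089] Helper file `--supports stmt-ResolutionOfSingularities-19897`
— KERNEL DOCUMENTATION OF A DESIGN POINT (in the manner of `…CentreFiltrationNotDeterminedByCentre` for (c9′) and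
`…IotaOrderConeSpecimen` for (c7)).  No statement of the manuscript under review (Hironaka 2017) is typed or used,
nothing is attributed to its author, nothing here is a claim about resolution of singularities.  AI-produced, weaker
than expert review.  Typer res-type-073 (reserve volunteer on res-L1-w43-plan-1's (o·) desk terms, TAKING-UNLESS-OBJECTED
2026-08-27T06:23:45Z).  PRIORITY OF THE REMARK: res-L1-w43-tri-2, TRIAGE v4 (D4) 2026-08-27T05:48:34Z («(strat)
EXCLUDES ι = ord as the EFT3 witness — specimen `(k[x,y,z]_0, z² + x³y³)`, `p ∉ {2,3}`»), recorded by the registrar in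
ORDER (o20) 05:52:59Z.  This file is the kernel form, over EVERY field (the argument below is characteristic-free).

## The computation

`A = k[x₀,x₁,x₂]` (`x = X 0`, `y = X 1`, `z = X 2`), `F = z² + x³y³`, `S = A_{(x,y,z)}` (`OriginLocalization k 3`, a
regular local ring essentially of finite type over `k`), `f = F/1 ∈ S`; branch primes `Q₁ = ker(x, z ↦ 0; y ↦ T) ⊇ (x, z)`,
`Q₂ = ker(y, z ↦ 0; x ↦ T) ⊇ (y, z)` of `A` and their extensions `QS₁, QS₂` to `S`.
* `ord_S f = 2`: `F ∈ 𝔪²`; and `F ∉ 𝔪³S` since otherwise `D^{(2e_z)} F ∈ 𝔪` (res-type-078's Hasse–Schmidt criterion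
  `hasseDeriv_mem_of_algebraMap_mem_maximalIdeal_pow`, direction valid over any field), whose value at the origin is
  the coefficient of `z²`, namely `1`.
* `ord_{𝔮ᵢ} f = 2`: `F ∈ Qᵢ²` gives `≥ 2`; generization monotonicity on the regular local `S` (`iotaOrd_generizationMonotone`)
  gives `≤ 2`.  So (strat) forces the centre prime `P ≤ QS₁` and `P ≤ QS₂`.
* (strat) at `𝔭 = P` forces `ord_P f = 2`, i.e. `F/1 ∈ 𝔪_{S_P}²`; with `P₀ = P ∩ A` the same Hasse criterion gives
  `D^{(e_z)}F = 2z ∈ P₀` and `D^{(e_x)}F = 3x²y³ ∈ P₀`.  If `2 ≠ 0` in `k`: `z ∈ P₀`, so `x³y³ = F − z² ∈ P₀`, so `x ∈ P₀ ⊆ Q₂`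
  or `y ∈ P₀ ⊆ Q₁` — both absurd.  If `2 = 0`: `3 = 1 ≠ 0`, so `x²y³ ∈ P₀`, same contradiction.
Hence NO prime `P` satisfies (strat) for `ι = iotaOrd` at this position: the max-`ord` locus `V(z, xy)` has two branches
through the origin and the order does not separate the origin from them.  Consequently `iotaOrd` is not the `ι` of any
witness of `LocalWeightedDropEFT3` / of the registered `LocalWeightedDropEFT4S` (`iotaOrd_not_eft3_witness`,
`iotaOrd_not_eft4S_witness`); a witness must REFINE the order (lexicographic combinator `iotaLex`, p504861).

## References

* res-L1-w43-tri-2, `L/res-L1-w43-tri-2/TRIAGE.md` §v4 (D4); res-L1-w43-plan-1, CRUX-PLAN Addendum 13 (OURS, AI).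
* O. Zariski, P. Samuel, *Commutative Algebra* II, Ch. VIII §1 (order function). [cite: ZariskiSamuel1960, VIII §1]
-/

noncomputable section

set_option linter.dupNamespace false -- mandated namespace `Summit.<Summit>.<Problem>` of this single-conjunct summit

open IsLocalRing MvPolynomial Finsupp
open Literature.AlgebraicGeometry.Resolution
open Summit.ResolutionOfSingularities.ResolutionOfSingularities.Theorems

namespace Summit.ResolutionOfSingularities.ResolutionOfSingularities.Cruxes.HypersurfaceCentreConstruction.LocalEngine

namespace StratSpecimen

variable (k : Type) [Field k]

/-! ## The specimen `F = z² + x³y³` and the branch primes -/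

/-- [OURS] The specimen `F = x₂² + x₀³x₁³ ∈ k[x₀,x₁,x₂]`. -/
def F : MvPolynomial (Fin 3) k := X 2 ^ 2 + X 0 ^ 3 * X 1 ^ 3

/-- [OURS] `F` as a sum of two monomials. -/
theorem F_eq : F k = monomial (single 2 2) 1 + monomial (single 0 3 + single 1 3) 1 := by
  simp only [F, X_pow_eq_monomial, monomial_mul, mul_one]

/-- The coefficient of `z²` in `F` is `1`. -/
theorem coeff_F_z2 : coeff (single (2 : Fin 3) 2) (F k) = 1 := by
  rw [F_eq, coeff_add, coeff_monomial, coeff_monomial, if_pos rfl, if_neg, add_zero]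
  intro h
  have := DFunLike.congr_fun h 2
  simp at this

/-- `F ≠ 0`. -/
theorem F_ne_zero : F k ≠ 0 := fun h => by simpa [h] using coeff_F_z2 k

/-- [OURS] The branch homomorphism `k[x₀,x₁,x₂] → k[T]`, `x₀, x₂ ↦ 0`, `x₁ ↦ T`. -/
def branchHom₁ : MvPolynomial (Fin 3) k →ₐ[k] Polynomial k := aeval ![0, Polynomial.X, 0]

/-- [OURS] The branch homomorphism `k[x₀,x₁,x₂] → k[T]`, `x₁, x₂ ↦ 0`, `x₀ ↦ T`. -/
def branchHom₂ : MvPolynomial (Fin 3) k →ₐ[k] Polynomial k := aeval ![Polynomial.X, 0, 0]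

/-- [OURS] The branch prime `Q₁ = (x₀, x₂)` (as a kernel). -/
def Q₁ : Ideal (MvPolynomial (Fin 3) k) := RingHom.ker (branchHom₁ k).toRingHom

/-- [OURS] The branch prime `Q₂ = (x₁, x₂)` (as a kernel). -/
def Q₂ : Ideal (MvPolynomial (Fin 3) k) := RingHom.ker (branchHom₂ k).toRingHom

/-- `Q₁` is prime. -/
instance Q₁_isPrime : (Q₁ k).IsPrime := RingHom.ker_isPrime _

/-- `Q₂` is prime. -/
instance Q₂_isPrime : (Q₂ k).IsPrime := RingHom.ker_isPrime _

/-- `x₀ ∈ Q₁`. -/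
theorem X0_mem_Q₁ : (X 0 : MvPolynomial (Fin 3) k) ∈ Q₁ k := by
  change (branchHom₁ k).toRingHom (X 0) = 0; simp [branchHom₁]
/-- `x₂ ∈ Q₁`. -/
theorem X2_mem_Q₁ : (X 2 : MvPolynomial (Fin 3) k) ∈ Q₁ k := by
  change (branchHom₁ k).toRingHom (X 2) = 0; simp [branchHom₁]
/-- `x₁ ∉ Q₁`. -/
theorem X1_not_mem_Q₁ : (X 1 : MvPolynomial (Fin 3) k) ∉ Q₁ k := by
  change ¬ (branchHom₁ k).toRingHom (X 1) = 0; simp [branchHom₁]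
/-- `x₁ ∈ Q₂`. -/
theorem X1_mem_Q₂ : (X 1 : MvPolynomial (Fin 3) k) ∈ Q₂ k := by
  change (branchHom₂ k).toRingHom (X 1) = 0; simp [branchHom₂]
/-- `x₂ ∈ Q₂`. -/
theorem X2_mem_Q₂ : (X 2 : MvPolynomial (Fin 3) k) ∈ Q₂ k := by
  change (branchHom₂ k).toRingHom (X 2) = 0; simp [branchHom₂]
/-- `x₀ ∉ Q₂`. -/
theorem X0_not_mem_Q₂ : (X 0 : MvPolynomial (Fin 3) k) ∉ Q₂ k := by
  change ¬ (branchHom₂ k).toRingHom (X 0) = 0; simp [branchHom₂]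

/-- `F ∈ Q₁²` (`z² ∈ Q₁²`, `x³ ∈ Q₁³ ⊆ Q₁²`). -/
theorem F_mem_Q₁_sq : F k ∈ Q₁ k ^ 2 := by
  refine add_mem (Ideal.pow_mem_pow (X2_mem_Q₁ k) 2) (Ideal.mul_mem_right _ _ ?_)
  exact Ideal.pow_le_pow_right (by norm_num) (Ideal.pow_mem_pow (X0_mem_Q₁ k) 3)

/-- `F ∈ Q₂²`. -/
theorem F_mem_Q₂_sq : F k ∈ Q₂ k ^ 2 := by
  refine add_mem (Ideal.pow_mem_pow (X2_mem_Q₂ k) 2) (Ideal.mul_mem_left _ _ ?_)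
  exact Ideal.pow_le_pow_right (by norm_num) (Ideal.pow_mem_pow (X1_mem_Q₂ k) 3)

/-- `F ∈ 𝔪²` for the ideal `𝔪` of the origin. -/
theorem F_mem_originIdeal_sq : F k ∈ originIdeal k 3 ^ 2 := by
  have hX : ∀ i : Fin 3, (X i : MvPolynomial (Fin 3) k) ∈ originIdeal k 3 := fun i =>
    (mem_originIdeal_iff k 3).2 (constantCoeff_X k i)
  refine add_mem (Ideal.pow_mem_pow (hX 2) 2) (Ideal.mul_mem_right _ _ ?_)
  exact Ideal.pow_le_pow_right (by norm_num) (Ideal.pow_mem_pow (hX 0) 3)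

/-- Evaluating at the origin factors through each branch homomorphism. -/
theorem aeval_zero_eq_comp₁ : (aeval (0 : Fin 3 → k)) = (Polynomial.aeval (0 : k)).comp (branchHom₁ k) := by
  apply MvPolynomial.algHom_ext; intro i; fin_cases i <;> simp [branchHom₁]

/-- Evaluating at the origin factors through each branch homomorphism. -/
theorem aeval_zero_eq_comp₂ : (aeval (0 : Fin 3 → k)) = (Polynomial.aeval (0 : k)).comp (branchHom₂ k) := by
  apply MvPolynomial.algHom_ext; intro i; fin_cases i <;> simp [branchHom₂]

/-- `Q₁ ⊆ 𝔪` (both branches pass through the origin). -/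
theorem Q₁_le_originIdeal : Q₁ k ≤ originIdeal k 3 := by
  intro g hg
  have hg' : branchHom₁ k g = 0 := hg
  have h0 : aeval (0 : Fin 3 → k) g = 0 := by
    rw [aeval_zero_eq_comp₁, AlgHom.comp_apply, hg', map_zero]
  rw [aeval_zero, Algebra.algebraMap_self, RingHom.id_apply] at h0
  exact (mem_originIdeal_iff k 3).2 h0

/-- `Q₂ ⊆ 𝔪`. -/
theorem Q₂_le_originIdeal : Q₂ k ≤ originIdeal k 3 := by
  intro g hg
  have hg' : branchHom₂ k g = 0 := hg
  have h0 : aeval (0 : Fin 3 → k) g = 0 := by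
    rw [aeval_zero_eq_comp₂, AlgHom.comp_apply, hg', map_zero]
  rw [aeval_zero, Algebra.algebraMap_self, RingHom.id_apply] at h0
  exact (mem_originIdeal_iff k 3).2 h0

/-- A prime inside `𝔪` misses the complement of `𝔪`. -/
theorem disjoint_primeCompl_of_le {Q : Ideal (MvPolynomial (Fin 3) k)} (hQ : Q ≤ originIdeal k 3) :
    Disjoint ((originIdeal k 3).primeCompl : Set (MvPolynomial (Fin 3) k)) Q :=
  Set.disjoint_left.2 fun _ hg hgQ => hg (hQ hgQ)

/-! ## The local ring `S = k[x,y,z]_{(x,y,z)}`, the element `f = F/1`, the branch primes of `S` -/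

/-- [OURS] `f = F/1` in `S = OriginLocalization k 3`. -/
def fS : OriginLocalization k 3 := algebraMap (MvPolynomial (Fin 3) k) (OriginLocalization k 3) (F k)

/-- `f ≠ 0` (`A → S` is injective on the domain `A`). -/
theorem fS_ne_zero : fS k ≠ 0 := by
  intro h
  apply F_ne_zero k
  have hinj := IsLocalization.injective (OriginLocalization k 3) (originIdeal k 3).primeCompl_le_nonZeroDivisors
  exact hinj (by rw [map_zero]; exact h)

/-- `f ∈ 𝔪_S²`. -/
theorem fS_mem_sq : fS k ∈ maximalIdeal (OriginLocalization k 3) ^ 2 := by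
  rw [← Localization.AtPrime.map_eq_maximalIdeal, ← Ideal.map_pow]
  exact Ideal.mem_map_of_mem _ (F_mem_originIdeal_sq k)

/-- `f ∉ 𝔪_S³`: otherwise `D^{(2e₂)}F ∈ 𝔪`, but its constant term is the coefficient `1` of `z²`. -/
theorem fS_not_mem_cube : fS k ∉ maximalIdeal (OriginLocalization k 3) ^ 3 := by
  intro h
  have hD := hasseDeriv_mem_of_algebraMap_mem_maximalIdeal_pow k (originIdeal k 3) (OriginLocalization k 3) h
    (β := single 2 2) (by rw [degree_single]; norm_num)
  rw [mem_originIdeal_iff, constantCoeff_hasseDeriv, coeff_F_z2] at hD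
  exact one_ne_zero hD

/-- **`ord_S f = 2`.** -/
theorem iotaOrd_fS : iotaOrd (OriginLocalization k 3) (fS k) = 2 := by
  have := (iotaOrd_eq_natCast_iff (OriginLocalization k 3) (fS k) 2).2 ⟨fS_mem_sq k, fS_not_mem_cube k⟩
  exact_mod_cast this

/-- [OURS] The branch prime `QS₁ = Q₁S` of `S`. -/
def QS₁ : Ideal (OriginLocalization k 3) := (Q₁ k).map (algebraMap _ _)

/-- [OURS] The branch prime `QS₂ = Q₂S` of `S`. -/
def QS₂ : Ideal (OriginLocalization k 3) := (Q₂ k).map (algebraMap _ _)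

/-- `QS₁` is prime. -/
instance QS₁_isPrime : (QS₁ k).IsPrime :=
  IsLocalization.isPrime_of_isPrime_disjoint _ (OriginLocalization k 3) _ inferInstance
    (disjoint_primeCompl_of_le k (Q₁_le_originIdeal k))

/-- `QS₂` is prime. -/
instance QS₂_isPrime : (QS₂ k).IsPrime :=
  IsLocalization.isPrime_of_isPrime_disjoint _ (OriginLocalization k 3) _ inferInstance
    (disjoint_primeCompl_of_le k (Q₂_le_originIdeal k))

/-- `QS₁ ∩ A = Q₁`. -/
theorem comap_QS₁ : (QS₁ k).comap (algebraMap _ _) = Q₁ k :=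
  IsLocalization.under_map_of_isPrime_disjoint (originIdeal k 3).primeCompl (OriginLocalization k 3)
    inferInstance (disjoint_primeCompl_of_le k (Q₁_le_originIdeal k))

/-- `QS₂ ∩ A = Q₂`. -/
theorem comap_QS₂ : (QS₂ k).comap (algebraMap _ _) = Q₂ k :=
  IsLocalization.under_map_of_isPrime_disjoint (originIdeal k 3).primeCompl (OriginLocalization k 3)
    inferInstance (disjoint_primeCompl_of_le k (Q₂_le_originIdeal k))

/-- `f ∈ QS₁`. -/
theorem fS_mem_QS₁ : fS k ∈ QS₁ k :=
  Ideal.mem_map_of_mem _ (Ideal.pow_le_self two_ne_zero (F_mem_Q₁_sq k))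

/-- `f ∈ QS₂`. -/
theorem fS_mem_QS₂ : fS k ∈ QS₂ k :=
  Ideal.mem_map_of_mem _ (Ideal.pow_le_self two_ne_zero (F_mem_Q₂_sq k))

/-- Along a prime `𝔭` of `S`, `F/1 ∈ S_𝔭` is the image of `f`. -/
theorem algebraMap_F_eq (𝔭 : Ideal (OriginLocalization k 3)) [𝔭.IsPrime] :
    algebraMap (MvPolynomial (Fin 3) k) (Localization.AtPrime 𝔭) (F k) =
      algebraMap (OriginLocalization k 3) (Localization.AtPrime 𝔭) (fS k) :=
  IsScalarTower.algebraMap_apply _ (OriginLocalization k 3) _ _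

/-- If `F ∈ Q²` for a prime `Q ⊆ 𝔪` of `A` then `ord_{QS} f ≥ 2`. -/
theorem two_le_iotaOrd_of_mem_sq {Q : Ideal (MvPolynomial (Fin 3) k)} (hF : F k ∈ Q ^ 2)
    (𝔭 : Ideal (OriginLocalization k 3)) [𝔭.IsPrime] (hQ : Q.map (algebraMap _ (OriginLocalization k 3)) ≤ 𝔭) :
    (2 : Ordinal) ≤ iotaOrd (Localization.AtPrime 𝔭)
      (algebraMap (OriginLocalization k 3) (Localization.AtPrime 𝔭) (fS k)) := by
  have h2 : ((2 : ℕ) : Ordinal) ≤ _ := (natCast_le_iotaOrd_iff (Localization.AtPrime 𝔭)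
      (algebraMap (OriginLocalization k 3) (Localization.AtPrime 𝔭) (fS k)) 2).2 (by
    rw [← algebraMap_F_eq]
    have hle : Q.map (algebraMap (MvPolynomial (Fin 3) k) (Localization.AtPrime 𝔭)) ≤
        maximalIdeal (Localization.AtPrime 𝔭) := by
      rw [Ideal.map_le_iff_le_comap]
      intro g hg
      rw [Ideal.mem_comap, IsScalarTower.algebraMap_apply _ (OriginLocalization k 3) _ g,
        IsLocalization.AtPrime.to_map_mem_maximal_iff (Localization.AtPrime 𝔭) 𝔭]
      exact hQ (Ideal.mem_map_of_mem _ hg)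
    exact Ideal.pow_right_mono hle 2 (by rw [← Ideal.map_pow]; exact Ideal.mem_map_of_mem _ hF))
  exact_mod_cast h2

/-- **`ord_{QS₁} f = ord_S f`** (both are `2`). -/
theorem iotaOrd_QS₁ : iotaOrd (Localization.AtPrime (QS₁ k))
    (algebraMap (OriginLocalization k 3) (Localization.AtPrime (QS₁ k)) (fS k)) =
      iotaOrd (OriginLocalization k 3) (fS k) :=
  le_antisymm (iotaOrd_generizationMonotone (OriginLocalization k 3) (QS₁ k) (fS k))
    (by rw [iotaOrd_fS]; exact two_le_iotaOrd_of_mem_sq k (F_mem_Q₁_sq k) _ le_rfl)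

/-- **`ord_{QS₂} f = ord_S f`.** -/
theorem iotaOrd_QS₂ : iotaOrd (Localization.AtPrime (QS₂ k))
    (algebraMap (OriginLocalization k 3) (Localization.AtPrime (QS₂ k)) (fS k)) =
      iotaOrd (OriginLocalization k 3) (fS k) :=
  le_antisymm (iotaOrd_generizationMonotone (OriginLocalization k 3) (QS₂ k) (fS k))
    (by rw [iotaOrd_fS]; exact two_le_iotaOrd_of_mem_sq k (F_mem_Q₂_sq k) _ le_rfl)

/-! ## First-order Hasse–Schmidt derivatives of `F` -/

/-- The first Hasse–Schmidt derivative in one direction is the partial derivative. [folklore] -/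
theorem hasseDeriv_single_one (i : Fin 3) (g : MvPolynomial (Fin 3) k) :
    hasseDeriv k (single i 1) g = pderiv i g := by
  ext m
  rw [coeff_hasseDeriv_single, coeff_pderiv, Nat.choose_one_right, mul_comm]
  push_cast
  ring

/-- `∂F/∂z = 2z`. -/
theorem pderiv_two_F : pderiv 2 (F k) = C 2 * X 2 := by
  simp only [F, map_add, Derivation.leibniz, Derivation.leibniz_pow, pderiv_X_self,
    pderiv_X_of_ne (show (0 : Fin 3) ≠ 2 by decide), pderiv_X_of_ne (show (1 : Fin 3) ≠ 2 by decide),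
    smul_eq_mul, mul_one, map_ofNat]
  ring

/-- `∂F/∂x = 3x²y³`. -/
theorem pderiv_zero_F : pderiv 0 (F k) = C 3 * (X 0 ^ 2 * X 1 ^ 3) := by
  simp only [F, map_add, Derivation.leibniz, Derivation.leibniz_pow, pderiv_X_self,
    pderiv_X_of_ne (show (2 : Fin 3) ≠ 0 by decide), pderiv_X_of_ne (show (1 : Fin 3) ≠ 0 by decide),
    smul_zero, zero_add, smul_eq_mul, mul_one, mul_zero, map_ofNat]
  ring

/-! ## No prime below both branches has order `2` -/

/-- **Key step.** If `P ⊂ S` is a prime containing `f` and contained in both branch primes, then `ord_P f < 2`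
(indeed `F/1 ∉ 𝔪_{S_P}²`): the first-order Hasse derivatives `2z`, `3x²y³` would lie in `P ∩ A ⊆ Q₁ ∩ Q₂`. -/
theorem not_two_le_iotaOrd_of_le (P : Ideal (OriginLocalization k 3)) [P.IsPrime] (hfP : fS k ∈ P)
    (h₁ : P ≤ QS₁ k) (h₂ : P ≤ QS₂ k) :
    ¬ (2 : Ordinal) ≤ iotaOrd (Localization.AtPrime P)
      (algebraMap (OriginLocalization k 3) (Localization.AtPrime P) (fS k)) := by
  intro h2
  set P₀ : Ideal (MvPolynomial (Fin 3) k) := P.comap (algebraMap _ (OriginLocalization k 3)) with hP₀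
  have hP₀₁ : P₀ ≤ Q₁ k := by rw [← comap_QS₁]; exact Ideal.comap_mono h₁
  have hP₀₂ : P₀ ≤ Q₂ k := by rw [← comap_QS₂]; exact Ideal.comap_mono h₂
  have hX0 : (X 0 : MvPolynomial (Fin 3) k) ∉ P₀ := fun h => X0_not_mem_Q₂ k (hP₀₂ h)
  have hX1 : (X 1 : MvPolynomial (Fin 3) k) ∉ P₀ := fun h => X1_not_mem_Q₁ k (hP₀₁ h)
  have hFP₀ : F k ∈ P₀ := by rw [hP₀, Ideal.mem_comap]; exact hfP
  -- `F/1 ∈ 𝔪_{S_P}²`, read over `A` at the prime `P₀`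
  have hmem : algebraMap (MvPolynomial (Fin 3) k) (Localization.AtPrime P) (F k) ∈
      maximalIdeal (Localization.AtPrime P) ^ 2 := by
    rw [algebraMap_F_eq]
    have := (natCast_le_iotaOrd_iff (Localization.AtPrime P) _ 2).1 (by exact_mod_cast h2)
    exact this
  have hD : ∀ i : Fin 3, pderiv i (F k) ∈ P₀ := fun i => by
    rw [← hasseDeriv_single_one]
    exact hasseDeriv_mem_of_algebraMap_mem_maximalIdeal_pow k P₀ (Localization.AtPrime P) hmem
      (by rw [degree_single]; norm_num)
  -- no product of powers of `x` and `y` lies in `P₀`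
  have hxy : ∀ a b : ℕ, (X 0 ^ a * X 1 ^ b : MvPolynomial (Fin 3) k) ∉ P₀ := fun a b hab => by
    rcases (inferInstance : P₀.IsPrime).mem_or_mem hab with h | h
    · exact hX0 ((inferInstance : P₀.IsPrime).mem_of_pow_mem _ h)
    · exact hX1 ((inferInstance : P₀.IsPrime).mem_of_pow_mem _ h)
  by_cases h2k : (2 : k) = 0
  · -- characteristic 2: `3 = 1`, so `∂F/∂x = 3x²y³ ∈ P₀` gives `x²y³ ∈ P₀`
    have h3 : IsUnit (C (3 : k) : MvPolynomial (Fin 3) k) := by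
      refine (isUnit_iff_ne_zero.2 ?_).map C
      intro h3
      have : (3 : k) - 2 = 0 := by rw [h3, h2k, sub_zero]
      norm_num at this
    have := hD 0
    rw [pderiv_zero_F, Ideal.unit_mul_mem_iff_mem _ h3] at this
    exact hxy 2 3 this
  · -- `2 ≠ 0`: `∂F/∂z = 2z ∈ P₀` gives `z ∈ P₀`, hence `x³y³ = F - z² ∈ P₀`
    have h2u : IsUnit (C (2 : k) : MvPolynomial (Fin 3) k) := (isUnit_iff_ne_zero.2 h2k).map C
    have hz := hD 2
    rw [pderiv_two_F, Ideal.unit_mul_mem_iff_mem _ h2u] at hz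
    have : (X 0 ^ 3 * X 1 ^ 3 : MvPolynomial (Fin 3) k) ∈ P₀ := by
      have h' : (X 0 ^ 3 * X 1 ^ 3 : MvPolynomial (Fin 3) k) = F k - X 2 ^ 2 := by rw [F]; ring
      rw [h']
      exact sub_mem hFP₀ (Ideal.pow_mem_of_mem _ hz 2 two_pos)
    exact hxy 3 3 this

/-- **(strat) fails for `ι = iotaOrd` at the position `(k[x,y,z]_{(x,y,z)}, z² + x³y³)`, over every field `k`**: there is
no prime `P ∋ f` of `S` such that the primes `𝔭 ∋ f` with `ord_𝔭 f = ord_S f` are exactly those above `P`. -/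
theorem not_strat (P : Ideal (OriginLocalization k 3)) [P.IsPrime] (hfP : fS k ∈ P)
    (hstrat : ∀ (𝔭 : Ideal (OriginLocalization k 3)) [𝔭.IsPrime], fS k ∈ 𝔭 →
      (iotaOrd (Localization.AtPrime 𝔭) (algebraMap (OriginLocalization k 3) (Localization.AtPrime 𝔭) (fS k)) =
          iotaOrd (OriginLocalization k 3) (fS k) ↔ P ≤ 𝔭)) : False := by
  have h₁ : P ≤ QS₁ k := (hstrat (QS₁ k) (fS_mem_QS₁ k)).1 (iotaOrd_QS₁ k)
  have h₂ : P ≤ QS₂ k := (hstrat (QS₂ k) (fS_mem_QS₂ k)).1 (iotaOrd_QS₂ k)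
  have hP : iotaOrd (Localization.AtPrime P) (algebraMap _ (Localization.AtPrime P) (fS k)) = 2 := by
    rw [(hstrat P hfP).2 le_rfl, iotaOrd_fS]
  exact not_two_le_iotaOrd_of_le k P hfP h₁ h₂ hP.ge

end StratSpecimen

/-! ## Consequences for the door's clause module -/

/-- **The order function is not the `ι` of the canonical game clause**: for every prime `p` and every centre-filtration
class function `J`, `¬ CanonicalGameClause p iotaOrd J` — instantiate the clause at the perfect field `𝔽_p` and the
position `(𝔽_p[x,y,z]_{(x,y,z)}, z² + x³y³)`; its (strat) conjunct is refuted by `StratSpecimen.not_strat`.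
[OURS · L1 W4.3 · kernel of res-L1-w43-tri-2 TRIAGE v4 (D4)] -/
theorem not_canonicalGameClause_iotaOrd (p : ℕ) [hp : Fact p.Prime]
    (J : (R : Type) → [CommRing R] → R → ℕ → Ideal R) : ¬ CanonicalGameClause p iotaOrd J := by
  intro h
  haveI : Algebra.EssFiniteType (ZMod p) (OriginLocalization (ZMod p) 3) :=
    Algebra.EssFiniteType.comp (ZMod p) (MvPolynomial (Fin 3) (ZMod p)) (OriginLocalization (ZMod p) 3)
  obtain ⟨P, hP, -, hfP, hstrat, -⟩ := h (ZMod p) (OriginLocalization (ZMod p) 3) (StratSpecimen.fS (ZMod p))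
    (StratSpecimen.fS_ne_zero (ZMod p)) (StratSpecimen.fS_mem_sq (ZMod p))
  haveI := hP
  exact StratSpecimen.not_strat (ZMod p) P hfP (fun 𝔭 _ h𝔭 => hstrat 𝔭 h𝔭)

/-- **`iotaOrd` is not the `ι` of any witness of H2a‴ `LocalWeightedDropEFT3 p`** (the conjunct list of
`LocalWeightedDropEFT3` with `ι := iotaOrd`, for any `J`, is contradictory) — the witness, if any, must REFINE the
order (tree combinator `iotaLex`). [OURS · L1 W4.3] -/
theorem iotaOrd_not_eft3_witness (p : ℕ) [Fact p.Prime] :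
    ¬ ∃ J : (R : Type) → [CommRing R] → R → ℕ → Ideal R,
      IotaIsoInvariant iotaOrd ∧ IotaGenerizationMonotone iotaOrd ∧ IotaUpperSemicontinuous iotaOrd ∧
      IotaTorusFactorMonotone iotaOrd ∧ JIsoInvariant J ∧ IotaJEssSmoothCompatible iotaOrd J ∧
      CanonicalGameClause p iotaOrd J ∧ JOpenPresentation p iotaOrd J ∧ IotaUnitInvariant iotaOrd ∧ JUnitInvariant J := by
  rintro ⟨J, -, -, -, -, -, -, hgame, -⟩
  exact not_canonicalGameClause_iotaOrd p J hgame

/-- **Nor of the REGISTERED key H2a⁗ `LocalWeightedDropEFT4S p`** (door skeleton v3.1, `stub_localWeightedDropEFT4S`; module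
`…HypersurfaceLocalGameEFT4S`): its conjunct list with `ι := iotaOrd` is contradictory for every `J`. [OURS · L1 W4.3] -/
theorem iotaOrd_not_eft4S_witness (p : ℕ) [Fact p.Prime] :
    ¬ ∃ J : (R : Type) → [CommRing R] → R → ℕ → Ideal R,
      IotaIsoInvariant iotaOrd ∧ IotaGenerizationMonotone iotaOrd ∧ IotaUpperSemicontinuous iotaOrd ∧
      IotaTorusFactorMonotone iotaOrd ∧ JIsoInvariant J ∧ IotaJEssSmoothCompatible iotaOrd J ∧
      CanonicalGameClause p iotaOrd J ∧ JOpenPresentationForallSing p iotaOrd J ∧ IotaUnitInvariant iotaOrd ∧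
      JUnitInvariant J := by
  rintro ⟨J, -, -, -, -, -, -, hgame, -⟩
  exact not_canonicalGameClause_iotaOrd p J hgame

end Summit.ResolutionOfSingularities.ResolutionOfSingularities.Cruxes.HypersurfaceCentreConstruction.LocalEngine

end
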